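/-
Copyright (c) 2026 the pub-hodgecm-mathlib formalisation cell (harness21).  Prover seat hodgecm-mathlib-K2Liu-p10 (g5), Track B «K2-LIT»,
#184♮ = hLiu418 = `stmt-HodgeConjecture-24832`; (σ) endgame organ, socket σ-9: the letter `hu` of the face (`unramValue (χ_{F,v}) ≠ 1` at an inert place).
-/
import Summits.HodgeConjecture.HodgeConjecture.Theorems.K2LiuLocalLFactorDefs                  -- ★ `chiF`, `unramValue`, `IsUnramifiedChar`
import Summits.HodgeConjecture.HodgeConjecture.Theorems.K2E1QuadraticHeckeCharCMPlaceValues   -- ★ `valueAtUniformizer_quadraticHeckeCharCM_of_nonsplit`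
import Literature.NumberTheory.Rogawski1990.LocalTransferAtOneMuTwistGlobal                     -- ★ `isUnramifiedAt_quadraticHeckeCharCM_of_isUnramifiedIn`
import Literature.NumberTheory.GelbartRogawski1991.CMSplittingCharLocalComponents                -- ★ `ideleBaseChange_localUnits_of_smul_eq`
import Literature.NumberTheory.Automorphic.UnitaryGroupNonsplitPlace                            -- ★ `PlacesOver.eq_of_smul_eq`
import Literature.RepresentationTheory.HarrisKudlaSweet1996.GlobalSplittingCharacters           -- ★ `IsSplittingChar`, `isSplittingChar_iff_of_odd`, `IsSplittingChar.pow`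
import Literature.NumberTheory.GaloisRepresentations.CMTypeHeckeCharacter                       -- ★ `isUnramifiedAt_iff_forall_valued_eq_one`
import HarnessLib

/-!
# Crux `HLiu418`, (σ) endgame, σ-9: THE LETTER `hu` — `unramValue (χ_{F,v}) = ε_v(ϖ_v) = −1 ≠ 1` AT AN INERT UNRAMIFIED PLACE

Cell `hodgecm-mathlib`, crux item hLiu418 = `stmt-HodgeConjecture-24832`, route of record `HCCMUnconditional`; squad K2 ∕ K2Liu, prover K2Liu-p10 (g5); organ lead K2Liu-p09 (g7)
(15:59:37Z: the face v6 takes `hu : unramValue (chiF (χ³)_v) ≠ 1` BY VALUE; «OWNER WANTED: the (L3)∕chiF lineage K2Liu-p03∕p10»).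
THEOREMS ONLY; lane `--supports stmt-HodgeConjecture-24832 --as helper`.

* §1 **`chiF_localComponent_eq_of_nonsplit`** — for Hecke characters `μ` of `L` and `μ₀` of `L⁺` with `μ(x_L) = μ₀(x)` on `𝕀_{L⁺}`, at a NON-SPLIT `v` (one place `w ∣ v`):
  `χ_{F,v}((μ_w)_w) = (μ₀)_v` as characters of `(L⁺_v)ˣ` (★ `chiF` is `Π_{w∣v} μ_w ∘ ι_w`; ★ `PlacesOver.eq_of_smul_eq`; ★ `ideleBaseChange_localUnits_of_smul_eq`).
* §2 **`chiF_localComponent_pow_eq_quadraticHeckeCharCM`** — for a splitting character `χ|_{𝕀_{L⁺}} = ε_{L∕L⁺}` (★ HKS (1.5)) and odd `k`: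
  `χ_{F,v}(((χ^k)_w)_w) = (ε_{L∕L⁺})_v`.
* §3 the bridge `IsUnramifiedAt ↔ IsUnramifiedChar (localComponent)` (`isUnramifiedChar_localComponent_iff`), `unramValue_localComponent_eq_valueAtUniformizer`, and
  **`hu_of_inert`**: at a non-split `v` unramified in `L∕L⁺`, `unramValue (L⁺) v (chiF … (fun w => (χ ^ k).localComponent w.1)) = −1`, hence **`≠ 1`** (`hu_ne_one_of_inert`;
  `k = 3` is the face's) — ★ `isUnramifiedAt_quadraticHeckeCharCM_of_isUnramifiedIn` + ★ `valueAtUniformizer_quadraticHeckeCharCM_of_nonsplit`.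
(At a RAMIFIED non-split `v` the character `ε_v` is ramified and `unramValue = 0 ≠ 1` as well; not typed here — the record's `v` is chosen inert.)

HONEST LABEL: HC_CM is proved only modulo the 7 printed citations (2 remaining named inputs: hLiu418 = stmt-HodgeConjecture-24832, h413 = stmt-HodgeConjecture-24833)
until rung 0 closes; helper, closes no item.
References: [HarrisKudlaSweet1996] §1 (1.5), §6 (6.14)–(6.16); [Omeara1963] §63C Example 63:16; [CasselsFrohlichANT1967] Ch. VII §1.1, §4.3; [KudlaSweet1997] §1.
-/

set_option autoImplicit false
set_option linter.dupNamespace false -- the mandated namespace repeats `HodgeConjecture.HodgeConjecture`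

noncomputable section

open NumberField IsDedekindDomain
open Literature.NumberTheory.GaloisRepresentations
open Literature.NumberTheory.Automorphic Literature.NumberTheory.Automorphic.UnitaryGroup
open Literature.NumberTheory.GelbartRogawski1991 Literature.NumberTheory.GelbartRogawski1991.UnitaryDualPair.LocalSplitting
open Literature.RepresentationTheory.HarrisKudlaSweet1996
open Summit.HodgeConjecture.HodgeConjecture.Cruxes.HLiu418.K2LiuLocalLFactorDefs
open Summit.HodgeConjecture.HodgeConjecture.Cruxes.H413.K2E1QuadraticHeckeCharCMPlaceValues

namespace Summit.HodgeConjecture.HodgeConjecture.Cruxes.HLiu418.K2LiuA7ValueSocketHu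

variable (L : Type) [Field L] [NumberField L] [IsCMField L] (v : HeightOneSpectrum (𝓞 ↥(maximalRealSubfield L)))
  (w : PlacesOver L v) (hw : IsCMField.complexConj L • w.1 = w.1)

/-! ## §1 `χ_{F,v}` of the local components of `μ` is the local component of `μ|_{𝕀_{L⁺}}` (non-split `v`) -/

include hw in
/-- **`χ_{F,v}((μ_w)_{w∣v}) = (μ₀)_v`** at a non-split `v`, for `μ(x_L) = μ₀(x)` on `𝕀_{L⁺}`: the product over the single place `w ∣ v` of `μ_w(ι_w u)` is
`μ(⟨u⟩_v ⊗ 1) = μ₀(⟨u⟩_v)`. [cite: CasselsFrohlichANT1967, Ch. VII §4.3] [cite: HarrisKudlaSweet1996, §6 (6.14)] -/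
theorem chiF_localComponent_eq_of_nonsplit (μ : HeckeCharacter L) (μ₀ : HeckeCharacter ↥(maximalRealSubfield L))
    (hμ : ∀ x : ideleGroup ↥(maximalRealSubfield L), μ (AdeleRing.ideleBaseChange (↥(maximalRealSubfield L)) L x) = μ₀ x) :
    chiF (↥(maximalRealSubfield L)) L v (fun w' : PlacesOver L v => μ.localComponent w'.1) = μ₀.localComponent v := by
  haveI : Algebra.IsQuadraticExtension ↥(maximalRealSubfield L) L := IsCMField.isQuadraticExtension L
  haveI : Unique (PlacesOver L v) := ⟨⟨w⟩, fun w' => PlacesOver.eq_of_smul_eq (IsCMField.complexConj L) (IsCMField.complexConj_ne_one L) w hw w'⟩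
  ext u
  rw [chiF_apply, Fintype.prod_unique, show (default : PlacesOver L v) = w from (Unique.eq_default w).symm, HeckeCharacter.localComponent_apply,
    ← ideleBaseChange_localUnits_of_smul_eq L v w hw u, hμ, HeckeCharacter.localComponent_apply]

/-! ## §2 Splitting characters: `χ_{F,v}(((χ^k)_w)_w) = (ε_{L∕L⁺})_v` for odd `k` -/

include hw in
/-- **`χ_{F,v}(((χ^k)_w)_{w∣v}) = (ε_{L∕L⁺})_v`** at a non-split `v`, for `χ|_{𝕀_{L⁺}} = ε_{L∕L⁺}` and odd `k` (`χ^k|_{𝕀_{L⁺}} = ε^k = ε`).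
[cite: HarrisKudlaSweet1996, §1 (1.5), §6 (6.14)] -/
theorem chiF_localComponent_pow_eq_quadraticHeckeCharCM {χ : HeckeCharacter L} (hχs : IsSplittingChar L 1 χ) {k : ℕ} (hk : Odd k) :
    chiF (↥(maximalRealSubfield L)) L v (fun w' : PlacesOver L v => (χ ^ k).localComponent w'.1) = (quadraticHeckeCharCM L).localComponent v := by
  refine chiF_localComponent_eq_of_nonsplit L v w hw (χ ^ k) (quadraticHeckeCharCM L) ?_
  have h : IsSplittingChar L (1 * k) (χ ^ k) := hχs.pow k
  rw [one_mul] at h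
  exact (isSplittingChar_iff_of_odd hk (χ ^ k)).1 h

/-! ## §3 `hu` at an inert unramified place -/

omit [IsCMField L] in
/-- the two unramifiedness predicates agree: `μ₀.IsUnramifiedAt v ↔ IsUnramifiedChar (μ₀)_v`. [cite: KudlaSweet1997, §1] -/
theorem isUnramifiedChar_localComponent_iff (μ₀ : HeckeCharacter ↥(maximalRealSubfield L)) :
    IsUnramifiedChar ((μ₀.localComponent v)) ↔ μ₀.IsUnramifiedAt v := by
  rw [HeckeCharacter.isUnramifiedAt_iff_forall_valued_eq_one]
  exact forall_congr' fun u => forall_congr' fun _ => by rw [HeckeCharacter.localComponent_apply]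

omit [IsCMField L] in
/-- for an unramified `μ₀`, K2Liu's Satake value is the tree's value at the uniformizer: `unramValue (μ₀)_v = μ₀(ϖ_v)`. [cite: KudlaSweet1997, §1] -/
theorem unramValue_localComponent_eq_valueAtUniformizer (μ₀ : HeckeCharacter ↥(maximalRealSubfield L)) (hμ : μ₀.IsUnramifiedAt v) :
    unramValue (↥(maximalRealSubfield L)) v (μ₀.localComponent v) = μ₀.valueAtUniformizer v := by
  rw [unramValue_eq_apply (↥(maximalRealSubfield L)) v ((isUnramifiedChar_localComponent_iff L v μ₀).2 hμ)
    (HeckeCharacter.valued_uniformizer (v := v)) (HeckeCharacter.uniformizer (↥(maximalRealSubfield L)) v).ne_zero,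
    HeckeCharacter.valueAtUniformizer, Units.mk0_val]

include hw in
/-- **`unramValue (χ_{F,v}) = −1`** for `χ_v := ((χ^k)_w)_w`, `χ` a splitting character, `k` odd, at a non-split place `v` UNRAMIFIED in `L∕L⁺` (`ε_v` is unramified with
`ε_v(ϖ_v) = −1`). [cite: Omeara1963, §63C Example 63:16] [cite: HarrisKudlaSweet1996, §6 (6.16)] -/
theorem unramValue_chiF_localComponent_pow_of_inert {χ : HeckeCharacter L} (hχs : IsSplittingChar L 1 χ) {k : ℕ} (hk : Odd k)
    (hunr : Algebra.IsUnramifiedIn (𝓞 L) v.asIdeal) :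
    unramValue (↥(maximalRealSubfield L)) v (chiF (↥(maximalRealSubfield L)) L v (fun w' : PlacesOver L v => (χ ^ k).localComponent w'.1)) = -1 := by
  rw [chiF_localComponent_pow_eq_quadraticHeckeCharCM L v w hw hχs hk,
    unramValue_localComponent_eq_valueAtUniformizer L v _ (Literature.NumberTheory.Rogawski1990.isUnramifiedAt_quadraticHeckeCharCM_of_isUnramifiedIn L hunr),
    valueAtUniformizer_quadraticHeckeCharCM_of_nonsplit L v w hw hunr]

include hw in
/-- **THE FACE's `hu`** (`k = 3`): `unramValue (chiF (Fp L) L v (fun w => (χ ^ 3).localComponent w.1)) ≠ 1` at a non-split place unramified in `L∕L⁺`.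
[cite: HarrisKudlaSweet1996, §6 (6.16)] [cite: Omeara1963, §63C Example 63:16] -/
theorem hu_ne_one_of_inert {χ : HeckeCharacter L} (hχs : IsSplittingChar L 1 χ) {k : ℕ} (hk : Odd k) (hunr : Algebra.IsUnramifiedIn (𝓞 L) v.asIdeal) :
    unramValue (↥(maximalRealSubfield L)) v (chiF (↥(maximalRealSubfield L)) L v (fun w' : PlacesOver L v => (χ ^ k).localComponent w'.1)) ≠ 1 := by
  rw [unramValue_chiF_localComponent_pow_of_inert L v w hw hχs hk hunr]
  norm_num

include hw in
/-- the face's literal instance `k = 3`. [cite: HarrisKudlaSweet1996, §6 (6.16)] -/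
theorem hu_three_ne_one_of_inert {χ : HeckeCharacter L} (hχs : IsSplittingChar L 1 χ) (hunr : Algebra.IsUnramifiedIn (𝓞 L) v.asIdeal) :
    unramValue (↥(maximalRealSubfield L)) v (chiF (↥(maximalRealSubfield L)) L v (fun w' : PlacesOver L v => (χ ^ 3).localComponent w'.1)) ≠ 1 :=
  hu_ne_one_of_inert L v w hw hχs (by decide) hunr

end Summit.HodgeConjecture.HodgeConjecture.Cruxes.HLiu418.K2LiuA7ValueSocketHu

end
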